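import Mathlib
import Summits.PneNP.PneNP.Theses.OverlapGapAlgebra
import Summits.PneNP.PneNP.Theorems.OverlapGapAlgebraSolvableImpliesStableSectionDensityLiftCount

/-!
# PneNP / OverlapGapAlgebra — crux `SolvableImpliesStableSection` (stmt-PneNP-2463):
# the DENSITY LIFT block (supplement) — the transfer in the crux's own quantifier shape

Support for crux `stmt-PneNP-2463` (`Summit.PneNP.PneNP.Theses.OverlapGapAlgebra.SolvableImpliesStableSection`).
The conclusion of the crux is stated with "for infinitely many `n`" (`∃ᶠ n in atTop`); this file gives
the upward density transfer `sissDL_transfer` in exactly that shape (`sissDL_transfer_frequently`): for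
`0 < α' < α`, `η > 0`, `ν' ≥ 0` and `ν'α' + 2^{-k}(α - α') < να`, the conclusion of the crux at
`(k, α', η, ν')` implies the conclusion at `(k, α, η, ν)` — so the f-free conclusion of
`SolvableImpliesStableSection`, as typed, is MONOTONE UPWARD in the density modulo the degradation
`ν ↦ ν·α'/α + 2^{-k}(1 - α'/α)` of the validity level (`sissDL_conclusion_mono`).  The proof is that of
`sissDL_transfer` (the lift `sissDL_count` at one large `n`), run inside `Filter.Frequently.mp`.

* `sissDL_transfer_frequently` — the transfer, frequent form (registered);
* `sissDL_conclusion_mono` — monotonicity of the all-`ν` conclusion in the density.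
No definitions; axioms `propext`, `Classical.choice`, `Quot.sound`.
-/

set_option linter.dupNamespace false -- `Summit.PneNP.PneNP.…`: summit = sub-problem (D-0017)

namespace Summit.PneNP.PneNP.Theorems

open Finset Filter
open scoped Classical

section DensityLiftFrequently

/-- **Upward density transfer of the conclusion, frequent form.** For every `k`, `0 < α' < α`, `η > 0`,
`ν' ≥ 0` and `ν` with `ν'α' + 2^{-k}(α - α') < να`: if for every `c' > 0`, for infinitely many `n`
(`m' = ⌊α' n⌋₊`), some map on `m'`-clause instances is `ν'm'`-valid at every splice point of the
Bresler–Huang path and `ηn`-stable between consecutive splice points on `≥ e^{-c'n}·#paths'`, then for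
every `c > 0`, for infinitely many `n` (`m = ⌊α n⌋₊`), some map on `m`-clause instances is `νm`-valid and
`ηn`-stable in the same sense on `≥ e^{-cn}·#paths` — the quantifier shape of the crux. -/
theorem sissDL_transfer_frequently (k : ℕ) (α' α η ν' ν : ℝ) (hα' : 0 < α') (hαα : α' < α) (hη : 0 < η)
    (hν' : 0 ≤ ν') (hν : ν' * α' + (1 / 2 : ℝ) ^ k * (α - α') < ν * α)
    (hC : ∀ c' : ℝ, 0 < c' → ∃ᶠ n : ℕ in atTop, ∀ m' : ℕ, m' = ⌊α' * n⌋₊ →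
      ∃ G : (Fin m' → Fin k → Fin n × Bool) → (Fin n → Bool),
        Real.exp (-(c' * n)) * Fintype.card (Fin (k + 1) → Fin m' → Fin k → Fin n × Bool) ≤
        ((Finset.univ.filter fun Ψ : Fin (k + 1) → Fin m' → Fin k → Fin n × Bool =>
          let P : Fin k → ℕ → Fin m' → Fin k → Fin n × Bool :=
            fun r q a b => if (a : ℕ) * k + b < q then Ψ r.succ a b else Ψ r.castSucc a b
          (∀ r : Fin k, ∀ q ≤ m' * k, ((Finset.univ.filter fun i : Fin m' =>
            ∀ j, G (P r q) (P r q i j).1 ≠ (P r q i j).2).card : ℝ) ≤ ν' * m') ∧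
          ∀ r : Fin k, ∀ q < m' * k,
            (hammingDist (G (P r q)) (G (P r (q + 1))) : ℝ) ≤ η * n).card : ℝ))
    (c : ℝ) (hc : 0 < c) :
    ∃ᶠ n : ℕ in atTop, ∀ m : ℕ, m = ⌊α * n⌋₊ →
      ∃ g : (Fin m → Fin k → Fin n × Bool) → (Fin n → Bool),
        Real.exp (-(c * n)) * Fintype.card (Fin (k + 1) → Fin m → Fin k → Fin n × Bool) ≤
        ((Finset.univ.filter fun Ψ : Fin (k + 1) → Fin m → Fin k → Fin n × Bool =>
          let P : Fin k → ℕ → Fin m → Fin k → Fin n × Bool :=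
            fun r q a b => if (a : ℕ) * k + b < q then Ψ r.succ a b else Ψ r.castSucc a b
          (∀ r : Fin k, ∀ q ≤ m * k, ((Finset.univ.filter fun i : Fin m =>
            ∀ j, g (P r q) (P r q i j).1 ≠ (P r q i j).2).card : ℝ) ≤ ν * m) ∧
          ∀ r : Fin k, ∀ q < m * k,
            (hammingDist (g (P r q)) (g (P r (q + 1))) : ℝ) ≤ η * n).card : ℝ) := by
  have hα : 0 < α := hα'.trans hαα
  set p : ℝ := (1 / 2 : ℝ) ^ k with hp
  have hp0 : 0 < p := by rw [hp]; positivity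
  have hν0 : 0 < ν := by
    have h1 : 0 ≤ ν' * α' + p * (α - α') := by
      have : 0 ≤ α - α' := by linarith
      positivity
    have h2 : 0 < ν * α := lt_of_le_of_lt h1 hν
    by_contra h
    push Not at h
    have : ν * α ≤ 0 := mul_nonpos_of_nonpos_of_nonneg h hα.le
    linarith
  -- the constants
  obtain ⟨τ, hτ⟩ : ∃ τ : ℝ, τ = (ν * α - (ν' * α' + p * (α - α'))) / 2 := ⟨_, rfl⟩
  have hτ0 : 0 < τ := by rw [hτ]; linarith
  have hkey : ν * α - ν' * α' - p * (α - α') = 2 * τ := by rw [hτ]; ring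
  obtain ⟨κ, hκ⟩ : ∃ κ : ℝ, κ = τ ^ 2 / (2 * (α - α' + 1)) := ⟨_, rfl⟩
  have hA0 : 0 < α - α' + 1 := by linarith
  have hκ0 : 0 < κ := by rw [hκ]; positivity
  obtain ⟨c₁, hc₁⟩ : ∃ c₁ : ℝ, c₁ = min c κ / 2 := ⟨_, rfl⟩
  have hc₁0 : 0 < c₁ := by rw [hc₁]; positivity
  have hc₁c : c₁ < c := by
    rw [hc₁]; have := min_le_left c κ; linarith
  have hc₁κ : c₁ < κ := by
    rw [hc₁]; have := min_le_right c κ; linarith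
  obtain ⟨b, hb⟩ : ∃ b : ℝ, b = κ - c₁ := ⟨_, rfl⟩
  have hb0 : 0 < b := by rw [hb]; linarith
  -- eventual facts
  have E0 : ∀ᶠ n : ℕ in atTop, 1 ≤ n := eventually_ge_atTop 1
  have E1 : ∀ᶠ n : ℕ in atTop, (1 + p + ν) / τ ≤ (n : ℝ) :=
    tendsto_natCast_atTop_atTop.eventually_ge_atTop _
  have E2 : ∀ᶠ n : ℕ in atTop, 1 / (α - α') ≤ (n : ℝ) :=
    tendsto_natCast_atTop_atTop.eventually_ge_atTop _
  have E3 : ∀ᶠ n : ℕ in atTop, 4 * k * (α * k + 1) / b ^ 2 ≤ (n : ℝ) :=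
    tendsto_natCast_atTop_atTop.eventually_ge_atTop _
  have E4 : ∀ᶠ n : ℕ in atTop, 1 / (c - c₁) ≤ (n : ℝ) :=
    tendsto_natCast_atTop_atTop.eventually_ge_atTop _
  refine (hC c₁ hc₁0).mp ((E0.and (E1.and (E2.and (E3.and E4)))).mono ?_)
  rintro n ⟨hn1, hE1, hE2, hE3, hE4⟩ hCn m hm
  have hnR : (1 : ℝ) ≤ n := by exact_mod_cast hn1
  have hn0 : (0 : ℝ) < n := by linarith
  -- the two instance sizes
  obtain ⟨m', hm'⟩ : ∃ m' : ℕ, m' = ⌊α' * n⌋₊ := ⟨_, rfl⟩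
  obtain ⟨G, hG⟩ := hCn m' hm'
  have hE1' : 1 + p + ν ≤ τ * n := by
    rw [mul_comm]; exact (div_le_iff₀ hτ0).1 hE1
  have hE2' : α' * n + 1 ≤ α * n := by
    have hαα' : 0 < α - α' := by linarith
    have h1 : 1 ≤ (α - α') * n := by rw [mul_comm]; exact (div_le_iff₀ hαα').1 hE2
    calc α' * n + 1 ≤ α' * n + (α - α') * n := by linarith
      _ = α * n := by ring
  have hE4' : 1 ≤ (c - c₁) * n := by
    have hcc : 0 < c - c₁ := by linarith
    rw [mul_comm]; exact (div_le_iff₀ hcc).1 hE4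
  have hmm' : m' ≤ m := by
    rw [hm, hm']
    exact Nat.floor_le_floor (mul_le_mul_of_nonneg_right hαα.le hn0.le)
  have hmR : (m : ℝ) ≤ α * n := by rw [hm]; exact Nat.floor_le (by positivity)
  have hmR' : α * n - 1 ≤ (m : ℝ) := by
    rw [hm]; have := Nat.lt_floor_add_one (α * n); linarith
  have hm'R : (m' : ℝ) ≤ α' * n := by rw [hm']; exact Nat.floor_le (by positivity)
  have hm'R' : α' * n - 1 ≤ (m' : ℝ) := by
    rw [hm']; have := Nat.lt_floor_add_one (α' * n); linarith
  have hdR : ((m - m' : ℕ) : ℝ) = (m : ℝ) - m' := Nat.cast_sub hmm'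
  have hd1 : (1 : ℝ) ≤ ((m - m' : ℕ) : ℝ) := by
    have h1 : m' + 1 ≤ m := by
      rw [hm, hm', ← Nat.floor_add_one (by positivity : (0 : ℝ) ≤ α' * n)]
      exact Nat.floor_le_floor hE2'
    have : ((m' + 1 : ℕ) : ℝ) ≤ m := by exact_mod_cast h1
    push_cast at this
    rw [hdR]; linarith
  have hd2 : ((m - m' : ℕ) : ℝ) ≤ (α - α' + 1) * n := by
    rw [hdR]
    calc (m : ℝ) - m' ≤ α * n - (α' * n - 1) := by linarith
      _ = (α - α') * n + 1 := by ring
      _ ≤ (α - α') * n + n := by linarith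
      _ = (α - α' + 1) * n := by ring
  -- `n^k/(2n)^k = 2^{-k}`
  have hpn : (n : ℝ) ^ k / (2 * (n : ℝ)) ^ k = p := by
    rw [hp, ← div_pow]
    congr 1
    field_simp
  -- the validity threshold
  have hV : ν' * m' + 1 + (n : ℝ) ^ k / (2 * (n : ℝ)) ^ k * ((m - m' : ℕ) : ℝ) + τ * n ≤ ν * m := by
    rw [hpn]
    have h1 : ν' * (m' : ℝ) ≤ ν' * α' * n := by
      rw [mul_assoc]; exact mul_le_mul_of_nonneg_left hm'R hν'
    have h2 : p * ((m - m' : ℕ) : ℝ) ≤ p * (α - α') * n + p := by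
      have : ((m - m' : ℕ) : ℝ) ≤ (α - α') * n + 1 := by rw [hdR]; linarith
      have := mul_le_mul_of_nonneg_left this hp0.le
      linarith [this]
    have h3 : ν * α * n - ν ≤ ν * m := by
      have := mul_le_mul_of_nonneg_left hmR' hν0.le
      linarith [this]
    have hkey' : ν * α * n - ν' * α' * n - p * (α - α') * n = 2 * (τ * n) := by
      calc ν * α * n - ν' * α' * n - p * (α - α') * n = (ν * α - ν' * α' - p * (α - α')) * n := by ring
        _ = 2 * τ * n := by rw [hkey]
        _ = 2 * (τ * n) := by ring
    linarith
  -- the count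
  have hcount := sissDL_count hmm' hn1 (ν' * m') (ν * m) (η * n) (τ * n) (Real.exp (-(c₁ * n)))
    (by positivity) (by positivity) hV G (fun Φ => G (fun a' => Φ (Fin.castLE hmm' a')))
    (fun _ => rfl) hG
  refine ⟨fun Φ => G (fun a' => Φ (Fin.castLE hmm' a')), le_trans ?_ hcount⟩
  refine mul_le_mul_of_nonneg_right ?_ (Nat.cast_nonneg _)
  -- `e^{-cn} ≤ e^{-c₁n} - k(mk+1)e^{-t²/(2(m-m'))}`
  have hexp1 : 2 * Real.exp (-(c * n)) ≤ Real.exp (-(c₁ * n)) := by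
    have h1 : (2 : ℝ) ≤ Real.exp ((c - c₁) * n) := by
      have := Real.add_one_le_exp ((c - c₁) * n); linarith
    have h2 : Real.exp (-(c₁ * n)) = Real.exp ((c - c₁) * n) * Real.exp (-(c * n)) := by
      rw [← Real.exp_add]; congr 1; ring
    rw [h2]
    exact mul_le_mul_of_nonneg_right h1 (Real.exp_pos _).le
  have htail : (k : ℝ) * (m * k + 1) * Real.exp (-((τ * n) ^ 2 / (2 * ((m - m' : ℕ) : ℝ)))) ≤
      Real.exp (-(c₁ * n)) / 2 := by
    -- (i) the exponent
    have hd0 : (0 : ℝ) < ((m - m' : ℕ) : ℝ) := by linarith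
    have hi : κ * n ≤ (τ * n) ^ 2 / (2 * ((m - m' : ℕ) : ℝ)) := by
      rw [hκ, le_div_iff₀ (by positivity)]
      calc τ ^ 2 / (2 * (α - α' + 1)) * n * (2 * ((m - m' : ℕ) : ℝ))
          = τ ^ 2 * n * (((m - m' : ℕ) : ℝ) / (α - α' + 1)) := by
            field_simp
        _ ≤ τ ^ 2 * n * n := by
            refine mul_le_mul_of_nonneg_left ?_ (by positivity)
            rw [div_le_iff₀ hA0]; linarith
        _ = (τ * n) ^ 2 := by ring
    have hii : Real.exp (-((τ * n) ^ 2 / (2 * ((m - m' : ℕ) : ℝ)))) ≤ Real.exp (-(κ * n)) :=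
      Real.exp_le_exp.2 (neg_le_neg hi)
    -- (ii) the polynomial factor
    have hk0 : (0 : ℝ) ≤ k := Nat.cast_nonneg _
    have hiii : (k : ℝ) * (m * k + 1) ≤ k * (α * k * n + 1) := by
      have h1 : (m : ℝ) * k ≤ α * n * k := mul_le_mul_of_nonneg_right hmR hk0
      calc (k : ℝ) * (m * k + 1) ≤ k * (α * n * k + 1) := mul_le_mul_of_nonneg_left (by linarith) hk0
        _ = k * (α * k * n + 1) := by ring
    -- (iii) the decay: `2k(αkn+1) e^{-bn} ≤ 1`
    have hiv : 2 * ((k : ℝ) * (α * k * n + 1)) * Real.exp (-(b * n)) ≤ 1 := by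
      have h1 : 2 * ((k : ℝ) * (α * k * n + 1)) ≤ 2 * k * (α * k + 1) * n := by
        have h11 : α * k * n + 1 ≤ α * k * n + n := by linarith
        calc 2 * ((k : ℝ) * (α * k * n + 1)) ≤ 2 * ((k : ℝ) * (α * k * n + n)) :=
              mul_le_mul_of_nonneg_left (mul_le_mul_of_nonneg_left h11 hk0) (by norm_num)
          _ = 2 * k * (α * k + 1) * n := by ring
      have h2 : 2 * (k : ℝ) * (α * k + 1) * n ≤ (b * n) ^ 2 / 2 := by
        have h21 : 4 * k * (α * k + 1) ≤ (n : ℝ) * b ^ 2 :=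
          (div_le_iff₀ (by positivity : (0 : ℝ) < b ^ 2)).1 hE3
        have h22 := mul_le_mul_of_nonneg_right h21 hn0.le
        calc 2 * (k : ℝ) * (α * k + 1) * n = 4 * k * (α * k + 1) * n / 2 := by ring
          _ ≤ (n : ℝ) * b ^ 2 * n / 2 := div_le_div_of_nonneg_right h22 (by norm_num)
          _ = (b * n) ^ 2 / 2 := by ring
      have h3 : (b * n) ^ 2 / 2 ≤ Real.exp (b * n) := by
        have := Real.pow_div_factorial_le_exp (b * n) (by positivity) 2
        simpa [Nat.factorial] using this
      have h4 : 2 * ((k : ℝ) * (α * k * n + 1)) ≤ Real.exp (b * n) := by linarith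
      have h5 : Real.exp (b * n) * Real.exp (-(b * n)) = 1 := by
        rw [← Real.exp_add, add_neg_cancel, Real.exp_zero]
      calc 2 * ((k : ℝ) * (α * k * n + 1)) * Real.exp (-(b * n))
          ≤ Real.exp (b * n) * Real.exp (-(b * n)) :=
            mul_le_mul_of_nonneg_right h4 (Real.exp_pos _).le
        _ = 1 := h5
    have hsplit : Real.exp (-(κ * n)) = Real.exp (-(b * n)) * Real.exp (-(c₁ * n)) := by
      rw [← Real.exp_add, hb]; congr 1; ring
    calc (k : ℝ) * (m * k + 1) * Real.exp (-((τ * n) ^ 2 / (2 * ((m - m' : ℕ) : ℝ))))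
        ≤ (k : ℝ) * (α * k * n + 1) * Real.exp (-(κ * n)) :=
          mul_le_mul hiii hii (Real.exp_pos _).le (by positivity)
      _ = ((k : ℝ) * (α * k * n + 1) * Real.exp (-(b * n))) * Real.exp (-(c₁ * n)) := by
          rw [hsplit]; ring
      _ ≤ (1 / 2) * Real.exp (-(c₁ * n)) := by
          refine mul_le_mul_of_nonneg_right ?_ (Real.exp_pos _).le
          linarith
      _ = Real.exp (-(c₁ * n)) / 2 := by ring
  linarith

/-- **The all-`ν` conclusion of the crux is monotone upward in the density, up to the truncation level.**
If the conclusion of `SolvableImpliesStableSection` holds at `(k, α', η, ν')` for EVERY `ν' > 0` (in the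
crux's own shape: for every `c > 0`, for infinitely many `n`), then it holds at `(k, α, η, ν)` for every
`α > α'` and every `ν > 2^{-k}(1 - α'/α)`. -/
theorem sissDL_conclusion_mono (k : ℕ) (α' α η ν : ℝ) (hα' : 0 < α') (hαα : α' < α) (hη : 0 < η)
    (hν : (1 / 2 : ℝ) ^ k * (1 - α' / α) < ν)
    (hC : ∀ ν' : ℝ, 0 < ν' → ∀ c' : ℝ, 0 < c' → ∃ᶠ n : ℕ in atTop, ∀ m' : ℕ, m' = ⌊α' * n⌋₊ →
      ∃ G : (Fin m' → Fin k → Fin n × Bool) → (Fin n → Bool),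
        Real.exp (-(c' * n)) * Fintype.card (Fin (k + 1) → Fin m' → Fin k → Fin n × Bool) ≤
        ((Finset.univ.filter fun Ψ : Fin (k + 1) → Fin m' → Fin k → Fin n × Bool =>
          let P : Fin k → ℕ → Fin m' → Fin k → Fin n × Bool :=
            fun r q a b => if (a : ℕ) * k + b < q then Ψ r.succ a b else Ψ r.castSucc a b
          (∀ r : Fin k, ∀ q ≤ m' * k, ((Finset.univ.filter fun i : Fin m' =>
            ∀ j, G (P r q) (P r q i j).1 ≠ (P r q i j).2).card : ℝ) ≤ ν' * m') ∧
          ∀ r : Fin k, ∀ q < m' * k,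
            (hammingDist (G (P r q)) (G (P r (q + 1))) : ℝ) ≤ η * n).card : ℝ))
    (c : ℝ) (hc : 0 < c) :
    ∃ᶠ n : ℕ in atTop, ∀ m : ℕ, m = ⌊α * n⌋₊ →
      ∃ g : (Fin m → Fin k → Fin n × Bool) → (Fin n → Bool),
        Real.exp (-(c * n)) * Fintype.card (Fin (k + 1) → Fin m → Fin k → Fin n × Bool) ≤
        ((Finset.univ.filter fun Ψ : Fin (k + 1) → Fin m → Fin k → Fin n × Bool =>
          let P : Fin k → ℕ → Fin m → Fin k → Fin n × Bool :=
            fun r q a b => if (a : ℕ) * k + b < q then Ψ r.succ a b else Ψ r.castSucc a b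
          (∀ r : Fin k, ∀ q ≤ m * k, ((Finset.univ.filter fun i : Fin m =>
            ∀ j, g (P r q) (P r q i j).1 ≠ (P r q i j).2).card : ℝ) ≤ ν * m) ∧
          ∀ r : Fin k, ∀ q < m * k,
            (hammingDist (g (P r q)) (g (P r (q + 1))) : ℝ) ≤ η * n).card : ℝ) := by
  have hα : 0 < α := hα'.trans hαα
  set p : ℝ := (1 / 2 : ℝ) ^ k with hp
  have hp0 : 0 < p := by rw [hp]; positivity
  -- `ν α > p (α - α')`; take `ν' := (ν α - p (α - α')) / (2 α')`
  have hgap : p * (α - α') < ν * α := by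
    have h1 : p * (1 - α' / α) * α = p * (α - α') := by field_simp
    have h2 := mul_lt_mul_of_pos_right hν hα
    linarith
  obtain ⟨ν', hν'⟩ : ∃ ν' : ℝ, ν' = (ν * α - p * (α - α')) / (2 * α') := ⟨_, rfl⟩
  have hν'0 : 0 < ν' := by rw [hν']; exact div_pos (by linarith) (by positivity)
  have hcond : ν' * α' + (1 / 2 : ℝ) ^ k * (α - α') < ν * α := by
    rw [← hp]
    have : ν' * α' = (ν * α - p * (α - α')) / 2 := by
      rw [hν']; field_simp
    linarith
  exact sissDL_transfer_frequently k α' α η ν' ν hα' hαα hη hν'0.le hcond (hC ν' hν'0) c hc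

end DensityLiftFrequently

end Summit.PneNP.PneNP.Theorems
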